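import Summits.Ventures.CertifiedManyBodySolver.Observables.StiffnessApexTransportWeightedBracket
import Summits.Ventures.CertifiedManyBodySolver.Observables.StiffnessApexTransportRayStation
import HarnessLib

/-!
# Ventures/CertifiedManyBodySolver — Observables/StiffnessApexTransportAffineFloors.lean

HONEST FRAMING: dictionary lemmas only — the hopping floors `ℓ(κ) ≤ e_{Φ(1,κ,0)}(ω)` that the tree's certified SOURCE shapes deliver on a torus-limit ground-state class,
written as AFFINE functions `α + βκ` of the hopping `κ` on a hopping RANGE (the input shape of the cleared / box masters of the companion
`Observables/StiffnessApexTransportFermiSeaBoxes.lean`, same seat, same session). One-sided; conditional on exactly the families they take; no number, no claim node, no `sorry`.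

Cell `pub/hubbard-fast` (D-0154 (1)(A)), seat `hubbard-fast-reuse-2` g6 (`prover-hubbard-fast-reuse-2-g6-0`), path family «APEX TRANSPORT», line «U-AFFINE BOXES».

* `affineHoppingFloor_of_ownSlot_floor` — own f-sum orbit-lower family `v` at the slot `s` + floor `B ≤ K₂` ⇒ `(4v − 2sB) + Bκ` on `κ ≥ 2s` (g3 `hoppingFloor_of_ownSlot_orbitLower_of_le_diagHop`);
* `affineHoppingFloor_of_ownSlot_ceil` — + ceiling `K₂ ≤ A` ⇒ `(4v − 2sA) + Aκ` on `κ ≤ 2s` (g3 §4);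
* `affineHoppingFloor_of_slotChord` — the σ-CHORD of two END objectives on one class (`orbitLower_slot_chord_of_two_endObjectives`) ⇒ `(4(σ_b v_a − σ_a v_b) + 2(v_b − v_a)κ)/(σ_b − σ_a)`
  on `κ ∈ [2σ_a, 2σ_b]`;
* `affineHoppingFloor_of_station_floor` / `…_ceil` — a `t′ = 0` station's kinetic ceiling `−k ≤ X` + `K₂` floor `B` (`κ ≥ 0`) / ceiling `A` (`κ ≤ 0`) ⇒ `−X + Bκ` / `−X + Aκ` (g4 ray station).
The idle range end (`κ_hi` resp. `κ_lo`) is a free parameter so that every adapter has the two-sided range shape the box theorems take.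

References: T. Hazra, N. Verma, M. Randeria, PRX 9 (2019) 031049, eq. (4) [HazraVermaRanderia2019]; T. Koma, H. Tasaki, J. Stat. Phys. 76 (1994) 745, §1 [KomaTasaki1994];
O. Bratteli, D. W. Robinson, Operator Algebras and Quantum Statistical Mechanics II (1997) §6.2.4 [BratteliRobinsonII1997]; S. Boyd, L. Vandenberghe, Convex Optimization (2004) §5.9
[BoydVandenberghe2004].
-/

noncomputable section

namespace Summit.Ventures.CertifiedManyBodySolver.Observables

open Literature.MathematicalPhysics.QuantumLattice
open Literature.MathematicalPhysics.QuantumLattice.ThermodynamicLimit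
open Literature.MathematicalPhysics.QuantumFieldTheory
open Literature.Probability.LatticeModels
open Matrix Finset Filter Topology HubbardWave0
open scoped Matrix BigOperators ComplexOrder

/-! ## The tree's source shapes as AFFINE hopping floors on a hopping range -/

section Adapters

variable {s U n : ℝ}

/-- **Own word + `K₂` FLOOR ⇒ affine hopping floor on `[2s, κ_hi]`.** An unconditional orbit-lower family `v ≤ |D₄|⁻¹Σ_γ Re ω_γ(−X₀(s, Uo))` at the class's own slot and a
floor `B ≤ K₂` on the class give `(4v − 2sB) + Bκ ≤ e_{Φ(1,κ,0)}(ω)` for every `κ ≥ 2s` (`hoppingFloor_of_ownSlot_orbitLower_of_le_diagHop`; `κ_hi` idle).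
[cite: HazraVermaRanderia2019, eq. (4)] [cite: KomaTasaki1994, §1] -/
theorem affineHoppingFloor_of_ownSlot_floor (Uo v κhi : ℝ)
    (h : ∀ (ω : InfVolFermionState 2) (Ls : ℕ → ℕ) (ψ : ∀ L, Fock (Orb (FermionTorus 2 L))),
      Tendsto Ls atTop atTop →
      (∀ j, IsGroundStateInSector (hubbardTorusTT' (Ls j) 1 s U) (rectN n (Ls j)) 0 (ψ (Ls j))) →
      (∀ j, star (ψ (Ls j)) ⬝ᵥ ψ (Ls j) = 1) → ω.IsTorusLimitOf ψ Ls →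
      v ≤ ((Finset.univ : Finset (DihedralGroup 4)).card : ℝ)⁻¹ * ∑ g ∈ (Finset.univ : Finset (DihedralGroup 4)),
        (ω.expect (d4ShiftSet g 0 (box 2 7)) (fermionEmbed (PolySite.d4Emb g 0 (box 2 7)) (-oddMomentObsTT s Uo 0))).re)
    {B : ℝ}
    (hB : ∀ (ω : InfVolFermionState 2) (Ls : ℕ → ℕ) (ψ : ∀ L, Fock (Orb (FermionTorus 2 L))),
      Tendsto Ls atTop atTop →
      (∀ j, IsGroundStateInSector (hubbardTorusTT' (Ls j) 1 s U) (rectN n (Ls j)) 0 (ψ (Ls j))) →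
      (∀ j, star (ψ (Ls j)) ⬝ᵥ ψ (Ls j) = 1) → ω.IsTorusLimitOf ψ Ls →
      B ≤ ω.meanEnergy (hubbardTTPrimeFermionInteraction 0 1 0) 1) :
    ∀ κ : ℝ, 2 * s ≤ κ → κ ≤ κhi →
      ∀ (ω : InfVolFermionState 2) (Ls : ℕ → ℕ) (ψ : ∀ L, Fock (Orb (FermionTorus 2 L))),
      Tendsto Ls atTop atTop →
      (∀ j, IsGroundStateInSector (hubbardTorusTT' (Ls j) 1 s U) (rectN n (Ls j)) 0 (ψ (Ls j))) →
      (∀ j, star (ψ (Ls j)) ⬝ᵥ ψ (Ls j) = 1) → ω.IsTorusLimitOf ψ Ls →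
      (4 * v - 2 * s * B) + B * κ ≤ ω.meanEnergy (hubbardTTPrimeFermionInteraction 1 κ 0) 1 := by
  intro κ hκ _ ω Ls ψ hLs hψ h1 hω
  have h' := hoppingFloor_of_ownSlot_orbitLower_of_le_diagHop Uo v hκ h hB ω Ls ψ hLs hψ h1 hω
  linarith

/-- **Own word + `K₂` CEILING ⇒ affine hopping floor on `[κ_lo, 2s]`.** With a ceiling `K₂ ≤ A` on the class: `(4v − 2sA) + Aκ ≤ e_{Φ(1,κ,0)}(ω)` for every `κ ≤ 2s`
(`hoppingFloor_of_ownSlot_orbitLower_of_diagHop_le`; `κ_lo` idle). [cite: HazraVermaRanderia2019, eq. (4)] [cite: KomaTasaki1994, §1] -/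
theorem affineHoppingFloor_of_ownSlot_ceil (Uo v κlo : ℝ)
    (h : ∀ (ω : InfVolFermionState 2) (Ls : ℕ → ℕ) (ψ : ∀ L, Fock (Orb (FermionTorus 2 L))),
      Tendsto Ls atTop atTop →
      (∀ j, IsGroundStateInSector (hubbardTorusTT' (Ls j) 1 s U) (rectN n (Ls j)) 0 (ψ (Ls j))) →
      (∀ j, star (ψ (Ls j)) ⬝ᵥ ψ (Ls j) = 1) → ω.IsTorusLimitOf ψ Ls →
      v ≤ ((Finset.univ : Finset (DihedralGroup 4)).card : ℝ)⁻¹ * ∑ g ∈ (Finset.univ : Finset (DihedralGroup 4)),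
        (ω.expect (d4ShiftSet g 0 (box 2 7)) (fermionEmbed (PolySite.d4Emb g 0 (box 2 7)) (-oddMomentObsTT s Uo 0))).re)
    {A : ℝ}
    (hA : ∀ (ω : InfVolFermionState 2) (Ls : ℕ → ℕ) (ψ : ∀ L, Fock (Orb (FermionTorus 2 L))),
      Tendsto Ls atTop atTop →
      (∀ j, IsGroundStateInSector (hubbardTorusTT' (Ls j) 1 s U) (rectN n (Ls j)) 0 (ψ (Ls j))) →
      (∀ j, star (ψ (Ls j)) ⬝ᵥ ψ (Ls j) = 1) → ω.IsTorusLimitOf ψ Ls →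
      ω.meanEnergy (hubbardTTPrimeFermionInteraction 0 1 0) 1 ≤ A) :
    ∀ κ : ℝ, κlo ≤ κ → κ ≤ 2 * s →
      ∀ (ω : InfVolFermionState 2) (Ls : ℕ → ℕ) (ψ : ∀ L, Fock (Orb (FermionTorus 2 L))),
      Tendsto Ls atTop atTop →
      (∀ j, IsGroundStateInSector (hubbardTorusTT' (Ls j) 1 s U) (rectN n (Ls j)) 0 (ψ (Ls j))) →
      (∀ j, star (ψ (Ls j)) ⬝ᵥ ψ (Ls j) = 1) → ω.IsTorusLimitOf ψ Ls →
      (4 * v - 2 * s * A) + A * κ ≤ ω.meanEnergy (hubbardTTPrimeFermionInteraction 1 κ 0) 1 := by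
  intro κ _ hκ ω Ls ψ hLs hψ h1 hω
  have h' := hoppingFloor_of_ownSlot_orbitLower_of_diagHop_le Uo v hκ h hA ω Ls ψ hLs hψ h1 hω
  linarith

/-- **σ-CHORD of two END objectives ⇒ affine hopping floor on `[2σ_a, 2σ_b]`.** An orbit-lower family for the END objective at every slot `σ ∈ [σ_a, σ_b]` (`σ_a < σ_b`) of the
CHORD shape `((σ_b − σ)/(σ_b − σ_a))v_a + ((σ − σ_a)/(σ_b − σ_a))v_b ≤ |D₄|⁻¹Σ_γ Re ω_γ(−X₀(σ, Uo))` (what `orbitLower_slot_chord_of_two_endObjectives` delivers from two END reads on one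
class) gives `(4(σ_b v_a − σ_a v_b) + 2(v_b − v_a)κ)/(σ_b − σ_a) ≤ e_{Φ(1,κ,0)}(ω)` for every `κ ∈ [2σ_a, 2σ_b]` (slot `σ = κ/2`, `hoppingFloor_of_slot_orbitLower`).
[cite: HazraVermaRanderia2019, eq. (4)] [cite: BoydVandenberghe2004, §5.9] -/
theorem affineHoppingFloor_of_slotChord (Uo : ℝ) {σa σb va vb : ℝ} (hσ : σa < σb)
    (h : ∀ σ ∈ Set.Icc σa σb, ∀ (ω : InfVolFermionState 2) (Ls : ℕ → ℕ) (ψ : ∀ L, Fock (Orb (FermionTorus 2 L))),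
      Tendsto Ls atTop atTop →
      (∀ j, IsGroundStateInSector (hubbardTorusTT' (Ls j) 1 s U) (rectN n (Ls j)) 0 (ψ (Ls j))) →
      (∀ j, star (ψ (Ls j)) ⬝ᵥ ψ (Ls j) = 1) → ω.IsTorusLimitOf ψ Ls →
      (σb - σ) / (σb - σa) * va + (σ - σa) / (σb - σa) * vb ≤
        ((Finset.univ : Finset (DihedralGroup 4)).card : ℝ)⁻¹ * ∑ g ∈ (Finset.univ : Finset (DihedralGroup 4)),
          (ω.expect (d4ShiftSet g 0 (box 2 7)) (fermionEmbed (PolySite.d4Emb g 0 (box 2 7)) (-oddMomentObsTT σ Uo 0))).re) :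
    ∀ κ : ℝ, 2 * σa ≤ κ → κ ≤ 2 * σb →
      ∀ (ω : InfVolFermionState 2) (Ls : ℕ → ℕ) (ψ : ∀ L, Fock (Orb (FermionTorus 2 L))),
      Tendsto Ls atTop atTop →
      (∀ j, IsGroundStateInSector (hubbardTorusTT' (Ls j) 1 s U) (rectN n (Ls j)) 0 (ψ (Ls j))) →
      (∀ j, star (ψ (Ls j)) ⬝ᵥ ψ (Ls j) = 1) → ω.IsTorusLimitOf ψ Ls →
      (4 * (σb * va - σa * vb)) / (σb - σa) + (2 * (vb - va)) / (σb - σa) * κ ≤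
        ω.meanEnergy (hubbardTTPrimeFermionInteraction 1 κ 0) 1 := by
  intro κ hlo hhi ω Ls ψ hLs hψ h1 hω
  have hd : 0 < σb - σa := sub_pos.2 hσ
  have hmem : κ / 2 ∈ Set.Icc σa σb := ⟨by linarith, by linarith⟩
  have h' := hoppingFloor_of_slot_orbitLower (s := s) (U := U) (n := n) (κ := κ) Uo
    ((σb - κ / 2) / (σb - σa) * va + (κ / 2 - σa) / (σb - σa) * vb) (σ := κ / 2) (by ring)
    (fun ω Ls ψ hLs hψ h1 hω => h (κ / 2) hmem ω Ls ψ hLs hψ h1 hω) ω Ls ψ hLs hψ h1 hω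
  have e : 4 * ((σb - κ / 2) / (σb - σa) * va + (κ / 2 - σa) / (σb - σa) * vb) =
      (4 * (σb * va - σa * vb)) / (σb - σa) + (2 * (vb - va)) / (σb - σa) * κ := by
    field_simp; ring
  linarith [e]

variable {U₀ : ℝ}

/-- **`t′ = 0` station: kinetic ceiling + `K₂` FLOOR ⇒ affine hopping floor on `[0, κ_hi]`**: `−X + Bκ ≤ e_{Φ(1,κ,0)}(ω)` on the class `(0, U₀, n)` for every `κ ≥ 0`
(`hoppingFloor_of_negKinetic_le_of_le_diagHop`; `κ_hi` idle). [cite: BratteliRobinsonII1997, §6.2.4] [cite: KomaTasaki1994, §1] -/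
theorem affineHoppingFloor_of_station_floor (κhi : ℝ) {X B : ℝ}
    (hX : ∀ (ω : InfVolFermionState 2) (Ls : ℕ → ℕ) (ψ : ∀ L, Fock (Orb (FermionTorus 2 L))),
      Tendsto Ls atTop atTop →
      (∀ j, IsGroundStateInSector (hubbardTorusTT' (Ls j) 1 0 U₀) (rectN n (Ls j)) 0 (ψ (Ls j))) →
      (∀ j, star (ψ (Ls j)) ⬝ᵥ ψ (Ls j) = 1) → ω.IsTorusLimitOf ψ Ls →
      -(∑ i : Fin 2, -(1 : ℝ) * ∑ σ : Fin 2,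
          ((ω.expect {0, 0 + unitVec i}
              ((cAt 0 (mem_insert_self _ _) σ)ᴴ * cAt (0 + unitVec i) (mem_insert_of_mem (mem_singleton_self _)) σ)).re +
            (ω.expect {0, 0 + unitVec i}
              ((cAt (0 + unitVec i) (mem_insert_of_mem (mem_singleton_self _)) σ)ᴴ * cAt 0 (mem_insert_self _ _) σ)).re)) ≤ X)
    (hB : ∀ (ω : InfVolFermionState 2) (Ls : ℕ → ℕ) (ψ : ∀ L, Fock (Orb (FermionTorus 2 L))),
      Tendsto Ls atTop atTop →
      (∀ j, IsGroundStateInSector (hubbardTorusTT' (Ls j) 1 0 U₀) (rectN n (Ls j)) 0 (ψ (Ls j))) →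
      (∀ j, star (ψ (Ls j)) ⬝ᵥ ψ (Ls j) = 1) → ω.IsTorusLimitOf ψ Ls →
      B ≤ ω.meanEnergy (hubbardTTPrimeFermionInteraction 0 1 0) 1) :
    ∀ κ : ℝ, 0 ≤ κ → κ ≤ κhi →
      ∀ (ω : InfVolFermionState 2) (Ls : ℕ → ℕ) (ψ : ∀ L, Fock (Orb (FermionTorus 2 L))),
      Tendsto Ls atTop atTop →
      (∀ j, IsGroundStateInSector (hubbardTorusTT' (Ls j) 1 0 U₀) (rectN n (Ls j)) 0 (ψ (Ls j))) →
      (∀ j, star (ψ (Ls j)) ⬝ᵥ ψ (Ls j) = 1) → ω.IsTorusLimitOf ψ Ls →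
      -X + B * κ ≤ ω.meanEnergy (hubbardTTPrimeFermionInteraction 1 κ 0) 1 := by
  intro κ hκ _ ω Ls ψ hLs hψ h1 hω
  have h' := hoppingFloor_of_negKinetic_le_of_le_diagHop (U₀ := U₀) (n := n) hκ hX hB ω Ls ψ hLs hψ h1 hω
  linarith

/-- **`t′ = 0` station: kinetic ceiling + `K₂` CEILING ⇒ affine hopping floor on `[κ_lo, 0]`**: `−X + Aκ ≤ e_{Φ(1,κ,0)}(ω)` on the class `(0, U₀, n)` for every `κ ≤ 0`
(`hoppingFloor_of_negKinetic_le_of_diagHop_le`; `κ_lo` idle). [cite: BratteliRobinsonII1997, §6.2.4] [cite: KomaTasaki1994, §1] -/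
theorem affineHoppingFloor_of_station_ceil (κlo : ℝ) {X A : ℝ}
    (hX : ∀ (ω : InfVolFermionState 2) (Ls : ℕ → ℕ) (ψ : ∀ L, Fock (Orb (FermionTorus 2 L))),
      Tendsto Ls atTop atTop →
      (∀ j, IsGroundStateInSector (hubbardTorusTT' (Ls j) 1 0 U₀) (rectN n (Ls j)) 0 (ψ (Ls j))) →
      (∀ j, star (ψ (Ls j)) ⬝ᵥ ψ (Ls j) = 1) → ω.IsTorusLimitOf ψ Ls →
      -(∑ i : Fin 2, -(1 : ℝ) * ∑ σ : Fin 2,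
          ((ω.expect {0, 0 + unitVec i}
              ((cAt 0 (mem_insert_self _ _) σ)ᴴ * cAt (0 + unitVec i) (mem_insert_of_mem (mem_singleton_self _)) σ)).re +
            (ω.expect {0, 0 + unitVec i}
              ((cAt (0 + unitVec i) (mem_insert_of_mem (mem_singleton_self _)) σ)ᴴ * cAt 0 (mem_insert_self _ _) σ)).re)) ≤ X)
    (hA : ∀ (ω : InfVolFermionState 2) (Ls : ℕ → ℕ) (ψ : ∀ L, Fock (Orb (FermionTorus 2 L))),
      Tendsto Ls atTop atTop →
      (∀ j, IsGroundStateInSector (hubbardTorusTT' (Ls j) 1 0 U₀) (rectN n (Ls j)) 0 (ψ (Ls j))) →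
      (∀ j, star (ψ (Ls j)) ⬝ᵥ ψ (Ls j) = 1) → ω.IsTorusLimitOf ψ Ls →
      ω.meanEnergy (hubbardTTPrimeFermionInteraction 0 1 0) 1 ≤ A) :
    ∀ κ : ℝ, κlo ≤ κ → κ ≤ 0 →
      ∀ (ω : InfVolFermionState 2) (Ls : ℕ → ℕ) (ψ : ∀ L, Fock (Orb (FermionTorus 2 L))),
      Tendsto Ls atTop atTop →
      (∀ j, IsGroundStateInSector (hubbardTorusTT' (Ls j) 1 0 U₀) (rectN n (Ls j)) 0 (ψ (Ls j))) →
      (∀ j, star (ψ (Ls j)) ⬝ᵥ ψ (Ls j) = 1) → ω.IsTorusLimitOf ψ Ls →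
      -X + A * κ ≤ ω.meanEnergy (hubbardTTPrimeFermionInteraction 1 κ 0) 1 := by
  intro κ _ hκ ω Ls ψ hLs hψ h1 hω
  have h' := hoppingFloor_of_negKinetic_le_of_diagHop_le (U₀ := U₀) (n := n) hκ hX hA ω Ls ψ hLs hψ h1 hω
  linarith

end Adapters


end Summit.Ventures.CertifiedManyBodySolver.Observables

end
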